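import Summits.FinalStateConjecture.FinalStateConjecture.Theorems.EIHFluxBalanceInertialRecessionStubHigherOrderRStep
import Summits.FinalStateConjecture.FinalStateConjecture.Theorems.EIHFluxBalanceInertialRecessionStubHigherOrderC3Step
import Summits.FinalStateConjecture.FinalStateConjecture.Theorems.EIHFluxBalanceInertialRecessionStubFirstOrderAbsorb

/-!
# Route EIHFluxBalance — `InertialRecession` (E′), line `SketchCleanExcision`, skeleton r13:
# registered stub `stub_higherOrderSlaving` (EF) — orders two and three of frozen-vacuum slaving

Helper file for the crux `stmt-FinalStateConjecture-17403`
(`Summit.FinalStateConjecture.FinalStateConjecture.Theses.EIHFluxBalance.InertialRecession`, E′).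
See the design memo `Cruxes/InertialRecession/Lines/SketchCleanExcision.md` (r13) for the role of
this stub: under the kinematic clauses of the crux antecedent, the coercivity clause (CB) of every
hole, the relative Ricci clause (RR) and the first-order conclusion FIRST, the second and third
lab-time jets of the painted moduli decay (HIGHER).

* `higherOrder_tendsto_firstSize` — FIRST gives the decay of the first-order sizes `E₁ⱼ → 0`.
* `higherOrder_second_decay` — the second-order step in the limit (`higherOrder_rstep`,
  `…StubHigherOrderRStep`) for every hole and linear absorption (`firstOrder_absorb`) give
  `E₂ⱼ → 0`.
* `higherOrder_third_decay` — the third-order step in the limit (`higherOrder_c3step`,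
  `…StubHigherOrderC3Step`) and absorption give `E₃ⱼ → 0`.
* `higherOrder_higher_of_sizes` — `E₂ⱼ, E₃ⱼ → 0` is HIGHER for hole `j`, componentwise.
* `stub_higherOrderSlaving` — the registered statement.

No definitions, no named facts, no `sorry`.
-/

set_option linter.dupNamespace false
set_option maxSynthPendingDepth 6
set_option synthInstance.maxHeartbeats 200000

noncomputable section

namespace Summit.FinalStateConjecture.FinalStateConjecture.Theorems.SublinearIsFree.Slaving

open scoped BigOperators Topology Manifold ContDiff ENNReal
open Filter Set Function TopologicalSpace Metric Literature.Geometry.Lorentzian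
  Literature.Geometry.Lorentzian.MetricCoord
open Summit.FinalStateConjecture.FinalStateConjecture.Theorems

/-! ### Sizes of one hole -/

/-- **FIRST gives the decay of the first-order size** `E₁ = ‖u̇‖ + ‖ξ̇ − v‖ + 𝟙_{a≠0}‖ṅ‖` of a
hole. [folklore] -/
theorem higherOrder_tendsto_firstSize {Λ : ℝ → lorentzGroup} {ξ : ℝ → E3} {a : ℝ} {E₁ : ℝ → ℝ}
    (hE₁ : ∀ t, E₁ t = ‖deriv (fun s ↦ (Λ s : E4 ≃L[ℝ] E4) (E4.basisVector 0)) t‖ +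
      ‖deriv ξ t - (((Λ t : E4 ≃L[ℝ] E4) (E4.basisVector 0)) 0)⁻¹ • E4.spatial ((Λ t : E4 ≃L[ℝ] E4) (E4.basisVector 0))‖ +
      (if a = 0 then 0 else ‖deriv (fun s ↦ (Λ s : E4 ≃L[ℝ] E4) (E4.basisVector 3)) t‖))
    (h1 : Tendsto (fun t ↦ iteratedDeriv 1 (fun s ↦ (((Λ s : lorentzGroup) : E4 ≃L[ℝ] E4)
      (E4.basisVector 0))) t) atTop (𝓝 0))
    (h2 : Tendsto (fun t ↦ iteratedDeriv 0 (fun s ↦ deriv ξ s -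
      (((((Λ s : lorentzGroup) : E4 ≃L[ℝ] E4) (E4.basisVector 0)) 0)⁻¹ •
        E4.spatial (((Λ s : lorentzGroup) : E4 ≃L[ℝ] E4) (E4.basisVector 0)))) t) atTop (𝓝 0))
    (h3 : a ≠ 0 → Tendsto (fun t ↦ iteratedDeriv 1 (fun s ↦ (((Λ s : lorentzGroup) : E4 ≃L[ℝ] E4)
      (E4.basisVector 3))) t) atTop (𝓝 0)) :
    Tendsto E₁ atTop (𝓝 0) := by
  have e : E₁ = fun t ↦ ‖deriv (fun s ↦ (Λ s : E4 ≃L[ℝ] E4) (E4.basisVector 0)) t‖ +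
      ‖deriv ξ t - (((Λ t : E4 ≃L[ℝ] E4) (E4.basisVector 0)) 0)⁻¹ • E4.spatial ((Λ t : E4 ≃L[ℝ] E4) (E4.basisVector 0))‖ +
      (if a = 0 then 0 else ‖deriv (fun s ↦ (Λ s : E4 ≃L[ℝ] E4) (E4.basisVector 3)) t‖) := funext hE₁
  rw [e]
  rw [iteratedDeriv_one] at h1
  rw [iteratedDeriv_zero] at h2
  have h1' := (tendsto_zero_iff_norm_tendsto_zero).1 h1
  have h2' := (tendsto_zero_iff_norm_tendsto_zero).1 h2
  have h12 := h1'.add h2'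
  rw [add_zero] at h12
  by_cases ha : a = 0
  · simp only [ha, if_true]
    have h := h12.add_const 0
    rw [zero_add] at h
    exact h
  · simp only [ha, if_false]
    have h3' := (tendsto_zero_iff_norm_tendsto_zero).1 (h3 ha)
    rw [iteratedDeriv_one] at h3'
    have h := h12.add h3'
    rw [add_zero] at h
    exact h

/-- **Registered one-line carrier form** (`higherOrder_firstSize_EF`) of
`higherOrder_tendsto_firstSize` (the registered signature of `stub_higherOrderSlaving` itself
exceeds the ledger's signature length). [folklore] -/
theorem higherOrder_firstSize_EF : open Literature.Geometry.Lorentzian in ∀ {Λ : ℝ → lorentzGroup} {ξ : ℝ → E3} {a : ℝ} {E₁ : ℝ → ℝ}, (∀ t, E₁ t = ‖deriv (fun s ↦ (Λ s : E4 ≃L[ℝ] E4) (E4.basisVector 0)) t‖ + ‖deriv ξ t - (((Λ t : E4 ≃L[ℝ] E4) (E4.basisVector 0)) 0)⁻¹ • E4.spatial ((Λ t : E4 ≃L[ℝ] E4) (E4.basisVector 0))‖ + (if a = 0 then 0 else ‖deriv (fun s ↦ (Λ s : E4 ≃L[ℝ] E4) (E4.basisVector 3)) t‖)) → Filter.Tendsto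 (fun t ↦ iteratedDeriv 1 (fun s ↦ (Λ s : E4 ≃L[ℝ] E4) (E4.basisVector 0)) t) Filter.atTop (nhds 0) → Filter.Tendsto (fun t ↦ iteratedDeriv 0 (fun s ↦ deriv ξ s - (((Λ s : E4 ≃L[ℝ] E4) (E4.basisVector 0)) 0)⁻¹ • E4.spatial ((Λ s : E4 ≃L[ℝ] E4) (E4.basisVector 0))) t) Filter.atTop (nhds 0) → (a ≠ 0 → Filter.Tendsto (fun t ↦ iteratedDeriv 1 (fun s ↦ (Λ s : E4 ≃L[ℝ] E4) (E4.basisVector 3)) t) Filter.atTop (nhds 0)) → Filter.Tendsto E₁ Filter.atTop (nhds 0) :=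
  fun hE₁ h1 h2 h3 ↦ higherOrder_tendsto_firstSize hE₁ h1 h2 h3

/-- **Decay of the second- and third-order sizes is HIGHER**, componentwise. [folklore] -/
theorem higherOrder_higher_of_sizes {Λ : ℝ → lorentzGroup} {ξ : ℝ → E3} {a : ℝ} {E₂ E₃ : ℝ → ℝ}
    (hE₂ : ∀ t, E₂ t = ‖iteratedDeriv 2 (fun s ↦ (Λ s : E4 ≃L[ℝ] E4) (E4.basisVector 0)) t‖ +
      ‖deriv (fun s ↦ deriv ξ s - (((Λ s : E4 ≃L[ℝ] E4) (E4.basisVector 0)) 0)⁻¹ •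
        E4.spatial ((Λ s : E4 ≃L[ℝ] E4) (E4.basisVector 0))) t‖ +
      (if a = 0 then 0 else ‖iteratedDeriv 2 (fun s ↦ (Λ s : E4 ≃L[ℝ] E4) (E4.basisVector 3)) t‖))
    (hE₃ : ∀ t, E₃ t = ‖iteratedDeriv 3 (fun s ↦ (Λ s : E4 ≃L[ℝ] E4) (E4.basisVector 0)) t‖ +
      ‖iteratedDeriv 2 (fun s ↦ deriv ξ s - (((Λ s : E4 ≃L[ℝ] E4) (E4.basisVector 0)) 0)⁻¹ •
        E4.spatial ((Λ s : E4 ≃L[ℝ] E4) (E4.basisVector 0))) t‖ +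
      (if a = 0 then 0 else ‖iteratedDeriv 3 (fun s ↦ (Λ s : E4 ≃L[ℝ] E4) (E4.basisVector 3)) t‖))
    (h2 : Tendsto E₂ atTop (𝓝 0)) (h3 : Tendsto E₃ atTop (𝓝 0)) :
    (Tendsto (fun t ↦ iteratedDeriv 2 (fun s ↦ (((Λ s : lorentzGroup) : E4 ≃L[ℝ] E4) (E4.basisVector 0))) t) atTop (𝓝 0) ∧
      Tendsto (fun t ↦ iteratedDeriv 3 (fun s ↦ (((Λ s : lorentzGroup) : E4 ≃L[ℝ] E4) (E4.basisVector 0))) t) atTop (𝓝 0)) ∧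
    (Tendsto (fun t ↦ iteratedDeriv 1 (fun s ↦ deriv ξ s - (((((Λ s : lorentzGroup) : E4 ≃L[ℝ] E4) (E4.basisVector 0)) 0)⁻¹ •
        E4.spatial (((Λ s : lorentzGroup) : E4 ≃L[ℝ] E4) (E4.basisVector 0)))) t) atTop (𝓝 0) ∧
      Tendsto (fun t ↦ iteratedDeriv 2 (fun s ↦ deriv ξ s - (((((Λ s : lorentzGroup) : E4 ≃L[ℝ] E4) (E4.basisVector 0)) 0)⁻¹ •
        E4.spatial (((Λ s : lorentzGroup) : E4 ≃L[ℝ] E4) (E4.basisVector 0)))) t) atTop (𝓝 0)) ∧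
    (a ≠ 0 → Tendsto (fun t ↦ iteratedDeriv 2 (fun s ↦ (((Λ s : lorentzGroup) : E4 ≃L[ℝ] E4) (E4.basisVector 3))) t) atTop (𝓝 0) ∧
      Tendsto (fun t ↦ iteratedDeriv 3 (fun s ↦ (((Λ s : lorentzGroup) : E4 ≃L[ℝ] E4) (E4.basisVector 3))) t) atTop (𝓝 0)) := by
  have hi2 : ∀ t, 0 ≤ (if a = 0 then 0 else ‖iteratedDeriv 2 (fun s ↦ (Λ s : E4 ≃L[ℝ] E4) (E4.basisVector 3)) t‖) :=
    fun t ↦ by split_ifs <;> positivity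
  have hi3 : ∀ t, 0 ≤ (if a = 0 then 0 else ‖iteratedDeriv 3 (fun s ↦ (Λ s : E4 ≃L[ℝ] E4) (E4.basisVector 3)) t‖) :=
    fun t ↦ by split_ifs <;> positivity
  refine ⟨⟨?_, ?_⟩, ⟨?_, ?_⟩, fun ha ↦ ⟨?_, ?_⟩⟩
  · refine tendsto_zero_iff_norm_tendsto_zero.2 (squeeze_zero (fun t ↦ norm_nonneg _) (fun t ↦ ?_) h2)
    rw [hE₂]
    linarith [hi2 t, norm_nonneg (deriv (fun s ↦ deriv ξ s - (((Λ s : E4 ≃L[ℝ] E4) (E4.basisVector 0)) 0)⁻¹ •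
      E4.spatial ((Λ s : E4 ≃L[ℝ] E4) (E4.basisVector 0))) t)]
  · refine tendsto_zero_iff_norm_tendsto_zero.2 (squeeze_zero (fun t ↦ norm_nonneg _) (fun t ↦ ?_) h3)
    rw [hE₃]
    linarith [hi3 t, norm_nonneg (iteratedDeriv 2 (fun s ↦ deriv ξ s - (((Λ s : E4 ≃L[ℝ] E4) (E4.basisVector 0)) 0)⁻¹ •
      E4.spatial ((Λ s : E4 ≃L[ℝ] E4) (E4.basisVector 0))) t)]
  · refine tendsto_zero_iff_norm_tendsto_zero.2 (squeeze_zero (fun t ↦ norm_nonneg _) (fun t ↦ ?_) h2)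
    rw [hE₂, iteratedDeriv_one]
    linarith [hi2 t, norm_nonneg (iteratedDeriv 2 (fun s ↦ (Λ s : E4 ≃L[ℝ] E4) (E4.basisVector 0)) t)]
  · refine tendsto_zero_iff_norm_tendsto_zero.2 (squeeze_zero (fun t ↦ norm_nonneg _) (fun t ↦ ?_) h3)
    rw [hE₃]
    linarith [hi3 t, norm_nonneg (iteratedDeriv 3 (fun s ↦ (Λ s : E4 ≃L[ℝ] E4) (E4.basisVector 0)) t)]
  · refine tendsto_zero_iff_norm_tendsto_zero.2 (squeeze_zero (fun t ↦ norm_nonneg _) (fun t ↦ ?_) h2)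
    rw [hE₂, if_neg ha]
    linarith [norm_nonneg (iteratedDeriv 2 (fun s ↦ (Λ s : E4 ≃L[ℝ] E4) (E4.basisVector 0)) t),
      norm_nonneg (deriv (fun s ↦ deriv ξ s - (((Λ s : E4 ≃L[ℝ] E4) (E4.basisVector 0)) 0)⁻¹ •
      E4.spatial ((Λ s : E4 ≃L[ℝ] E4) (E4.basisVector 0))) t)]
  · refine tendsto_zero_iff_norm_tendsto_zero.2 (squeeze_zero (fun t ↦ norm_nonneg _) (fun t ↦ ?_) h3)
    rw [hE₃, if_neg ha]
    linarith [norm_nonneg (iteratedDeriv 3 (fun s ↦ (Λ s : E4 ≃L[ℝ] E4) (E4.basisVector 0)) t),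
      norm_nonneg (iteratedDeriv 2 (fun s ↦ deriv ξ s - (((Λ s : E4 ≃L[ℝ] E4) (E4.basisVector 0)) 0)⁻¹ •
      E4.spatial ((Λ s : E4 ≃L[ℝ] E4) (E4.basisVector 0))) t)]

/-! ### Decay of the higher-order sizes of all holes -/

section Decay

variable {N : ℕ} {M a rin : Fin N → ℝ} {Λ : Fin N → ℝ → lorentzGroup} {ξ : Fin N → ℝ → E3} {γ : ℝ}

/-- **Decay of the second-order sizes.** The second-order step in the limit for every hole
(`higherOrder_rstep`) and linear absorption (`firstOrder_absorb`). [folklore] -/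
theorem higherOrder_second_decay
    (H1 : ∀ i, Kerr.IsSubextremal (M i) (a i) ∧ Kerr.rMinus (M i) (a i) < rin i ∧ rin i < Kerr.rPlus (M i) (a i))
    (Hγ : ∀ i t, |((Λ i t : E4 ≃L[ℝ] E4) (E4.basisVector 0)) 0| ≤ γ)
    (Hsm : ∀ i, ContDiff ℝ ∞ (ξ i) ∧ ContDiff ℝ ∞ (fun t ↦ ((Λ i t : E4 ≃L[ℝ] E4) : E4 →L[ℝ] E4)))
    (Hsep : ∀ i j, i ≠ j → Tendsto (fun t ↦ ‖ξ i t - ξ j t‖) atTop atTop)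
    (CB : ∀ i : Fin N, (∃ c ρin ρout η₀ : ℝ, 0 < c ∧ 0 < η₀ ∧ 0 < ρin ∧ ρin ≤ ρout ∧ (∀ (L : lorentzGroup) (y : E3), |((L : E4 ≃L[ℝ] E4) (E4.basisVector 0)) 0| ≤ γ → ρin ≤ ‖y‖ → 2 * (M i) < Kerr.radius (a i) (poincareInv L 0 (E4.ofTimeSpace 0 y))) ∧ ∀ (L : lorentzGroup) (A : E4 →L[ℝ] E4) (d : E4) (G G' : E4 → E4 →L[ℝ] E4 →L[ℝ] ℝ) (V : Set E4), |((L : E4 ≃L[ℝ] E4) (E4.basisVector 0)) 0| ≤ γ → (∀ u w : E4, Minkowski.bilin (A u) w + Minkowski.bilin u (A w) = 0) → MetricCoord.IsMetricOn G V → MetricCoord.IsMetricOn G' V → (∀ y : E3, ρin ≤ ‖y‖ → ‖y‖ ≤ ρout → (E4.ofTimeSpace 0 y) ∈ V ∧ ‖G (E4.ofTimeSpace 0 y) - boostedKerrBilin L 0 (M i) (a i) (E4.ofTimeSpace 0 y)‖ ≤ η₀ ∧ G' (E4.ofTimeSpace 0 y) = G (E4.ofTimeSpace 0 y) ∧ fderiv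 ℝ G' (E4.ofTimeSpace 0 y) = fderiv ℝ G (E4.ofTimeSpace 0 y) ∧ ∀ v : E4, fderiv ℝ (fderiv ℝ G') (E4.ofTimeSpace 0 y) v = fderiv ℝ (fderiv ℝ G) (E4.ofTimeSpace 0 y) v + (v 0) • (E4.dx 0).smulRight ((fderiv ℝ (Kerr.bilin (M i) (a i)) (poincareInv L 0 (E4.ofTimeSpace 0 y)) (A (poincareInv L 0 (E4.ofTimeSpace 0 y)) + d)).bilinearComp (((L : E4 ≃L[ℝ] E4).symm : E4 →L[ℝ] E4)) (((L : E4 ≃L[ℝ] E4).symm : E4 →L[ℝ] E4)) + (Kerr.bilin (M i) (a i) (poincareInv L 0 (E4.ofTimeSpace 0 y))).bilinearComp (A.comp (((L : E4 ≃L[ℝ] E4).symm : E4 →L[ℝ] E4))) (((L : E4 ≃L[ℝ] E4).symm : E4 →L[ℝ] E4)) + (Kerr.bilin (M i) (a i) (poincareInv L 0 (E4.ofTimeSpace 0 y))).bilinearComp (((L : E4 ≃L[ℝ] E4).symm : E4 →L[ℝ] E4)) (A.comp (((L : E4 ≃L[ℝ] E4).symm : E4 →L[ℝ] E4))))) → ∃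 y : E3, ρin ≤ ‖y‖ ∧ ‖y‖ ≤ ρout ∧ c * (‖A (E4.basisVector 0)‖ + ‖E4.spatial d‖ + ‖(a i) • A (E4.basisVector 3)‖) ≤ ‖MetricCoord.ricAt G' (E4.ofTimeSpace 0 y) - MetricCoord.ricAt G (E4.ofTimeSpace 0 y)‖))
    (RR : (∀ (i : Fin N) (R r₀ : ℝ), rin i ≤ r₀ → ∀ ε : ℝ, 0 < ε → ∃ T : ℝ, ∀ x : E4, T < x 0 → ‖E4.spatial x - ξ i (x 0)‖ < R → r₀ < Kerr.radius (a i) (poincareInv (Λ i (x 0)) (E4.ofTimeSpace (x 0) (ξ i (x 0))) x) → ∀ l : ℝ, 1 ≤ l → ‖fderiv ℝ (fun z : E4 ↦ Minkowski.bilin + ∑ i, (boostedKerrBilin (Λ i (z 0)) (E4.ofTimeSpace (z 0) (ξ i (z 0))) (M i) (a i) z - Minkowski.bilin)) x‖ ≤ l → ‖fderiv ℝ (fderiv ℝ (fun z : E4 ↦ Minkowski.bilin + ∑ i, (boostedKerrBilin (Λ i (z 0)) (E4.ofTimeSpace (z 0) (ξ i (z 0))) (M i) (a i) z - Minkowski.bilin)))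 x‖ ≤ l ^ 2 → ‖MetricCoord.ricAt (fun z : E4 ↦ Minkowski.bilin + ∑ i, (boostedKerrBilin (Λ i (z 0)) (E4.ofTimeSpace (z 0) (ξ i (z 0))) (M i) (a i) z - Minkowski.bilin)) x‖ ≤ ε * l ^ 2 ∧ (‖fderiv ℝ (fderiv ℝ (fderiv ℝ (fun z : E4 ↦ Minkowski.bilin + ∑ i, (boostedKerrBilin (Λ i (z 0)) (E4.ofTimeSpace (z 0) (ξ i (z 0))) (M i) (a i) z - Minkowski.bilin)))) x‖ ≤ l ^ 3 → ‖fderiv ℝ (MetricCoord.ricAt (fun z : E4 ↦ Minkowski.bilin + ∑ i, (boostedKerrBilin (Λ i (z 0)) (E4.ofTimeSpace (z 0) (ξ i (z 0))) (M i) (a i) z - Minkowski.bilin))) x‖ ≤ ε * l ^ 3)))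
    {E₁ E₂ : Fin N → ℝ → ℝ}
    (hE₁ : ∀ j t, E₁ j t = ‖deriv (fun s ↦ (Λ j s : E4 ≃L[ℝ] E4) (E4.basisVector 0)) t‖ +
      ‖deriv (ξ j) t - (((Λ j t : E4 ≃L[ℝ] E4) (E4.basisVector 0)) 0)⁻¹ • E4.spatial ((Λ j t : E4 ≃L[ℝ] E4) (E4.basisVector 0))‖ +
      (if a j = 0 then 0 else ‖deriv (fun s ↦ (Λ j s : E4 ≃L[ℝ] E4) (E4.basisVector 3)) t‖))
    (hE₂ : ∀ j t, E₂ j t = ‖iteratedDeriv 2 (fun s ↦ (Λ j s : E4 ≃L[ℝ] E4) (E4.basisVector 0)) t‖ +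
      ‖deriv (fun s ↦ deriv (ξ j) s - (((Λ j s : E4 ≃L[ℝ] E4) (E4.basisVector 0)) 0)⁻¹ •
        E4.spatial ((Λ j s : E4 ≃L[ℝ] E4) (E4.basisVector 0))) t‖ +
      (if a j = 0 then 0 else ‖iteratedDeriv 2 (fun s ↦ (Λ j s : E4 ≃L[ℝ] E4) (E4.basisVector 3)) t‖))
    (hfirst : ∀ j, Tendsto (E₁ j) atTop (𝓝 0)) (i : Fin N) : Tendsto (E₂ i) atTop (𝓝 0) := by
  refine firstOrder_absorb (red := E₂) one_pos (fun j t ↦ ?_) (fun ε hε ↦ ?_) i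
  · rw [hE₂]; positivity
  · obtain ⟨T, hT⟩ := eventually_atTop.1 (eventually_all.2 fun j ↦
      higherOrder_rstep H1 Hγ Hsm Hsep j (CB j) RR hE₁ hE₂ hfirst hε)
    exact ⟨T, fun t ht j ↦ by rw [one_mul]; exact hT t ht j⟩

/-- **Decay of the third-order sizes.** The third-order step in the limit for every hole
(`higherOrder_c3step`) and linear absorption (`firstOrder_absorb`). [folklore] -/
theorem higherOrder_third_decay
    (H1 : ∀ i, Kerr.IsSubextremal (M i) (a i) ∧ Kerr.rMinus (M i) (a i) < rin i ∧ rin i < Kerr.rPlus (M i) (a i))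
    (Hγ : ∀ i t, |((Λ i t : E4 ≃L[ℝ] E4) (E4.basisVector 0)) 0| ≤ γ)
    (Hsm : ∀ i, ContDiff ℝ ∞ (ξ i) ∧ ContDiff ℝ ∞ (fun t ↦ ((Λ i t : E4 ≃L[ℝ] E4) : E4 →L[ℝ] E4)))
    (Hsep : ∀ i j, i ≠ j → Tendsto (fun t ↦ ‖ξ i t - ξ j t‖) atTop atTop)
    (CB : ∀ i : Fin N, (∃ c ρin ρout η₀ : ℝ, 0 < c ∧ 0 < η₀ ∧ 0 < ρin ∧ ρin ≤ ρout ∧ (∀ (L : lorentzGroup) (y : E3), |((L : E4 ≃L[ℝ] E4) (E4.basisVector 0)) 0| ≤ γ → ρin ≤ ‖y‖ → 2 * (M i) < Kerr.radius (a i) (poincareInv L 0 (E4.ofTimeSpace 0 y))) ∧ ∀ (L : lorentzGroup) (A : E4 →L[ℝ] E4) (d : E4) (G G' : E4 → E4 →L[ℝ] E4 →L[ℝ] ℝ) (V : Set E4), |((L : E4 ≃L[ℝ] E4) (E4.basisVector 0)) 0| ≤ γ → (∀ u w : E4, Minkowski.bilin (A u) w + Minkowski.bilin u (A w) = 0) →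 MetricCoord.IsMetricOn G V → MetricCoord.IsMetricOn G' V → (∀ y : E3, ρin ≤ ‖y‖ → ‖y‖ ≤ ρout → (E4.ofTimeSpace 0 y) ∈ V ∧ ‖G (E4.ofTimeSpace 0 y) - boostedKerrBilin L 0 (M i) (a i) (E4.ofTimeSpace 0 y)‖ ≤ η₀ ∧ G' (E4.ofTimeSpace 0 y) = G (E4.ofTimeSpace 0 y) ∧ fderiv ℝ G' (E4.ofTimeSpace 0 y) = fderiv ℝ G (E4.ofTimeSpace 0 y) ∧ ∀ v : E4, fderiv ℝ (fderiv ℝ G') (E4.ofTimeSpace 0 y) v = fderiv ℝ (fderiv ℝ G) (E4.ofTimeSpace 0 y) v + (v 0) • (E4.dx 0).smulRight ((fderiv ℝ (Kerr.bilin (M i) (a i)) (poincareInv L 0 (E4.ofTimeSpace 0 y)) (A (poincareInv L 0 (E4.ofTimeSpace 0 y)) + d)).bilinearComp (((L : E4 ≃L[ℝ] E4).symm : E4 →L[ℝ] E4)) (((L : E4 ≃L[ℝ] E4).symm : E4 →L[ℝ] E4)) + (Kerr.bilin (M i) (a i) (poincareInv L 0 (E4.ofTimeSpace 0 y))).bilinearComp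 (A.comp (((L : E4 ≃L[ℝ] E4).symm : E4 →L[ℝ] E4))) (((L : E4 ≃L[ℝ] E4).symm : E4 →L[ℝ] E4)) + (Kerr.bilin (M i) (a i) (poincareInv L 0 (E4.ofTimeSpace 0 y))).bilinearComp (((L : E4 ≃L[ℝ] E4).symm : E4 →L[ℝ] E4)) (A.comp (((L : E4 ≃L[ℝ] E4).symm : E4 →L[ℝ] E4))))) → ∃ y : E3, ρin ≤ ‖y‖ ∧ ‖y‖ ≤ ρout ∧ c * (‖A (E4.basisVector 0)‖ + ‖E4.spatial d‖ + ‖(a i) • A (E4.basisVector 3)‖) ≤ ‖MetricCoord.ricAt G' (E4.ofTimeSpace 0 y) - MetricCoord.ricAt G (E4.ofTimeSpace 0 y)‖))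
    (RR : (∀ (i : Fin N) (R r₀ : ℝ), rin i ≤ r₀ → ∀ ε : ℝ, 0 < ε → ∃ T : ℝ, ∀ x : E4, T < x 0 → ‖E4.spatial x - ξ i (x 0)‖ < R → r₀ < Kerr.radius (a i) (poincareInv (Λ i (x 0)) (E4.ofTimeSpace (x 0) (ξ i (x 0))) x) → ∀ l : ℝ, 1 ≤ l → ‖fderiv ℝ (fun z : E4 ↦ Minkowski.bilin + ∑ i, (boostedKerrBilin (Λ i (z 0)) (E4.ofTimeSpace (z 0) (ξ i (z 0))) (M i) (a i) z - Minkowski.bilin)) x‖ ≤ l → ‖fderiv ℝ (fderiv ℝ (fun z : E4 ↦ Minkowski.bilin + ∑ i, (boostedKerrBilin (Λ i (z 0)) (E4.ofTimeSpace (z 0) (ξ i (z 0))) (M i) (a i) z - Minkowski.bilin))) x‖ ≤ l ^ 2 → ‖MetricCoord.ricAt (fun z : E4 ↦ Minkowski.bilin + ∑ i, (boostedKerrBilin (Λ i (z 0)) (E4.ofTimeSpace (z 0) (ξ i (z 0))) (M i) (a i) z - Minkowski.bilin)) x‖ ≤ ε * l ^ 2 ∧ (‖fderiv ℝ (fderiv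 ℝ (fderiv ℝ (fun z : E4 ↦ Minkowski.bilin + ∑ i, (boostedKerrBilin (Λ i (z 0)) (E4.ofTimeSpace (z 0) (ξ i (z 0))) (M i) (a i) z - Minkowski.bilin)))) x‖ ≤ l ^ 3 → ‖fderiv ℝ (MetricCoord.ricAt (fun z : E4 ↦ Minkowski.bilin + ∑ i, (boostedKerrBilin (Λ i (z 0)) (E4.ofTimeSpace (z 0) (ξ i (z 0))) (M i) (a i) z - Minkowski.bilin))) x‖ ≤ ε * l ^ 3)))
    {E₁ E₂ E₃ : Fin N → ℝ → ℝ}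
    (hE₁ : ∀ j t, E₁ j t = ‖deriv (fun s ↦ (Λ j s : E4 ≃L[ℝ] E4) (E4.basisVector 0)) t‖ +
      ‖deriv (ξ j) t - (((Λ j t : E4 ≃L[ℝ] E4) (E4.basisVector 0)) 0)⁻¹ • E4.spatial ((Λ j t : E4 ≃L[ℝ] E4) (E4.basisVector 0))‖ +
      (if a j = 0 then 0 else ‖deriv (fun s ↦ (Λ j s : E4 ≃L[ℝ] E4) (E4.basisVector 3)) t‖))
    (hE₂ : ∀ j t, E₂ j t = ‖iteratedDeriv 2 (fun s ↦ (Λ j s : E4 ≃L[ℝ] E4) (E4.basisVector 0)) t‖ +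
      ‖deriv (fun s ↦ deriv (ξ j) s - (((Λ j s : E4 ≃L[ℝ] E4) (E4.basisVector 0)) 0)⁻¹ •
        E4.spatial ((Λ j s : E4 ≃L[ℝ] E4) (E4.basisVector 0))) t‖ +
      (if a j = 0 then 0 else ‖iteratedDeriv 2 (fun s ↦ (Λ j s : E4 ≃L[ℝ] E4) (E4.basisVector 3)) t‖))
    (hE₃ : ∀ j t, E₃ j t = ‖iteratedDeriv 3 (fun s ↦ (Λ j s : E4 ≃L[ℝ] E4) (E4.basisVector 0)) t‖ +
      ‖iteratedDeriv 2 (fun s ↦ deriv (ξ j) s - (((Λ j s : E4 ≃L[ℝ] E4) (E4.basisVector 0)) 0)⁻¹ •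
        E4.spatial ((Λ j s : E4 ≃L[ℝ] E4) (E4.basisVector 0))) t‖ +
      (if a j = 0 then 0 else ‖iteratedDeriv 3 (fun s ↦ (Λ j s : E4 ≃L[ℝ] E4) (E4.basisVector 3)) t‖))
    (hfirst : ∀ j, Tendsto (E₁ j) atTop (𝓝 0)) (hsecond : ∀ j, Tendsto (E₂ j) atTop (𝓝 0)) (i : Fin N) :
    Tendsto (E₃ i) atTop (𝓝 0) := by
  refine firstOrder_absorb (red := E₃) one_pos (fun j t ↦ ?_) (fun ε hε ↦ ?_) i
  · rw [hE₃]; positivity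
  · obtain ⟨T, hT⟩ := eventually_atTop.1 (eventually_all.2 fun j ↦
      higherOrder_c3step H1 Hγ Hsm Hsep j (CB j) RR hE₁ hE₂ hE₃ hfirst hsecond hε)
    exact ⟨T, fun t ht j ↦ by rw [one_mul]; exact hT t ht j⟩

end Decay

/-! ### The registered statement -/

set_option maxHeartbeats 1600000 in
/-- **Orders two and three of frozen-vacuum slaving (stub (EF) of skeleton r13).** Under the
kinematic clauses of the crux antecedent, the coercivity clause (CB) of every hole
(`stub_coerSymbolQuant`), the relative Ricci clause (RR) of the frozen vacuum and the first-order
conclusion FIRST (`stub_firstOrderSlaving`), the second and third lab-time jets of the painted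
moduli decay: `üᵢ, u⃛ᵢ → 0`, `(ξ̇ᵢ − vᵢ)˙, (ξ̇ᵢ − vᵢ)¨ → 0`, and `n̈ᵢ, n⃛ᵢ → 0` if `aᵢ ≠ 0`
(per-hole coercivity applied to the re-centred frozen ansatz at every late time, the modelling
error of the lab-time variations being linear in the sizes of all holes with small coefficients,
then linear absorption; Kerr–Schild 1965, §§2–3 for the ingredients). [cite: KerrSchild1965, §3] -/
theorem stub_higherOrderSlaving :
    ∀ (N : ℕ) (M a rin : Fin N → ℝ) (Λ : Fin N → ℝ → lorentzGroup) (ξ : Fin N → ℝ → E3) (γ : ℝ), (∀ i, Kerr.IsSubextremal (M i) (a i) ∧ Kerr.rMinus (M i) (a i) < rin i ∧ rin i < Kerr.rPlus (M i) (a i)) → (∀ i t, |((Λ i t : E4 ≃L[ℝ] E4) (E4.basisVector 0)) 0| ≤ γ) → (∀ i, ContDiff ℝ ((⊤ : ℕ∞) : WithTop ℕ∞) (ξ i) ∧ ContDiff ℝ ((⊤ : ℕ∞) : WithTop ℕ∞) (fun t ↦ ((Λ i t : E4 ≃L[ℝ] E4) : E4 →L[ℝ] E4))) → (∀ i j, i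 ≠ j → Tendsto (fun t ↦ ‖ξ i t - ξ j t‖) atTop atTop) → (∀ i : Fin N, (∃ c ρin ρout η₀ : ℝ, 0 < c ∧ 0 < η₀ ∧ 0 < ρin ∧ ρin ≤ ρout ∧ (∀ (L : lorentzGroup) (y : E3), |((L : E4 ≃L[ℝ] E4) (E4.basisVector 0)) 0| ≤ γ → ρin ≤ ‖y‖ → 2 * (M i) < Kerr.radius (a i) (poincareInv L 0 (E4.ofTimeSpace 0 y))) ∧ ∀ (L : lorentzGroup) (A : E4 →L[ℝ] E4) (d : E4) (G G' : E4 → E4 →L[ℝ] E4 →L[ℝ] ℝ) (V : Set E4), |((L : E4 ≃L[ℝ] E4) (E4.basisVector 0)) 0| ≤ γ → (∀ u w : E4, Minkowski.bilin (A u) w + Minkowski.bilin u (A w) = 0) → MetricCoord.IsMetricOn G V → MetricCoord.IsMetricOn G' V → (∀ y : E3, ρin ≤ ‖y‖ → ‖y‖ ≤ ρout → (E4.ofTimeSpace 0 y) ∈ V ∧ ‖G (E4.ofTimeSpace 0 y) - boostedKerrBilin L 0 (M i) (a i) (E4.ofTimeSpace 0 y)‖ ≤ η₀ ∧ G' (E4.ofTimeSpace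 0 y) = G (E4.ofTimeSpace 0 y) ∧ fderiv ℝ G' (E4.ofTimeSpace 0 y) = fderiv ℝ G (E4.ofTimeSpace 0 y) ∧ ∀ v : E4, fderiv ℝ (fderiv ℝ G') (E4.ofTimeSpace 0 y) v = fderiv ℝ (fderiv ℝ G) (E4.ofTimeSpace 0 y) v + (v 0) • (E4.dx 0).smulRight ((fderiv ℝ (Kerr.bilin (M i) (a i)) (poincareInv L 0 (E4.ofTimeSpace 0 y)) (A (poincareInv L 0 (E4.ofTimeSpace 0 y)) + d)).bilinearComp (((L : E4 ≃L[ℝ] E4).symm : E4 →L[ℝ] E4)) (((L : E4 ≃L[ℝ] E4).symm : E4 →L[ℝ] E4)) + (Kerr.bilin (M i) (a i) (poincareInv L 0 (E4.ofTimeSpace 0 y))).bilinearComp (A.comp (((L : E4 ≃L[ℝ] E4).symm : E4 →L[ℝ] E4))) (((L : E4 ≃L[ℝ] E4).symm : E4 →L[ℝ] E4)) + (Kerr.bilin (M i) (a i) (poincareInv L 0 (E4.ofTimeSpace 0 y))).bilinearComp (((L : E4 ≃L[ℝ] E4).symm : E4 →L[ℝ] E4)) (A.comp (((L : E4 ≃L[ℝ]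 E4).symm : E4 →L[ℝ] E4))))) → ∃ y : E3, ρin ≤ ‖y‖ ∧ ‖y‖ ≤ ρout ∧ c * (‖A (E4.basisVector 0)‖ + ‖E4.spatial d‖ + ‖(a i) • A (E4.basisVector 3)‖) ≤ ‖MetricCoord.ricAt G' (E4.ofTimeSpace 0 y) - MetricCoord.ricAt G (E4.ofTimeSpace 0 y)‖)) → (∀ (i : Fin N) (R r₀ : ℝ), rin i ≤ r₀ → ∀ ε : ℝ, 0 < ε → ∃ T : ℝ, ∀ x : E4, T < x 0 → ‖E4.spatial x - ξ i (x 0)‖ < R → r₀ < Kerr.radius (a i) (poincareInv (Λ i (x 0)) (E4.ofTimeSpace (x 0) (ξ i (x 0))) x) → ∀ l : ℝ, 1 ≤ l → ‖fderiv ℝ (fun z : E4 ↦ Minkowski.bilin + ∑ i, (boostedKerrBilin (Λ i (z 0)) (E4.ofTimeSpace (z 0) (ξ i (z 0))) (M i) (a i) z - Minkowski.bilin)) x‖ ≤ l → ‖fderiv ℝ (fderiv ℝ (fun z : E4 ↦ Minkowski.bilin + ∑ i, (boostedKerrBilin (Λ i (z 0)) (E4.ofTimeSpace (z 0) (ξ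 i (z 0))) (M i) (a i) z - Minkowski.bilin))) x‖ ≤ l ^ 2 → ‖MetricCoord.ricAt (fun z : E4 ↦ Minkowski.bilin + ∑ i, (boostedKerrBilin (Λ i (z 0)) (E4.ofTimeSpace (z 0) (ξ i (z 0))) (M i) (a i) z - Minkowski.bilin)) x‖ ≤ ε * l ^ 2 ∧ (‖fderiv ℝ (fderiv ℝ (fderiv ℝ (fun z : E4 ↦ Minkowski.bilin + ∑ i, (boostedKerrBilin (Λ i (z 0)) (E4.ofTimeSpace (z 0) (ξ i (z 0))) (M i) (a i) z - Minkowski.bilin)))) x‖ ≤ l ^ 3 → ‖fderiv ℝ (MetricCoord.ricAt (fun z : E4 ↦ Minkowski.bilin + ∑ i, (boostedKerrBilin (Λ i (z 0)) (E4.ofTimeSpace (z 0) (ξ i (z 0))) (M i) (a i) z - Minkowski.bilin))) x‖ ≤ ε * l ^ 3)) → (∀ i : Fin N, Tendsto (fun t ↦ iteratedDeriv 1 (fun s ↦ (((Λ i s : lorentzGroup) : E4 ≃L[ℝ] E4) (E4.basisVector 0))) t) atTop (𝓝 0) ∧ Tendsto (fun t ↦ iteratedDeriv 0 (fun s ↦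 deriv (ξ i) s - (((((Λ i s : lorentzGroup) : E4 ≃L[ℝ] E4) (E4.basisVector 0)) 0)⁻¹ • E4.spatial (((Λ i s : lorentzGroup) : E4 ≃L[ℝ] E4) (E4.basisVector 0)))) t) atTop (𝓝 0) ∧ (a i ≠ 0 → Tendsto (fun t ↦ iteratedDeriv 1 (fun s ↦ (((Λ i s : lorentzGroup) : E4 ≃L[ℝ] E4) (E4.basisVector 3))) t) atTop (𝓝 0))) → (∀ i : Fin N, (Tendsto (fun t ↦ iteratedDeriv 2 (fun s ↦ (((Λ i s : lorentzGroup) : E4 ≃L[ℝ] E4) (E4.basisVector 0))) t) atTop (𝓝 0) ∧ Tendsto (fun t ↦ iteratedDeriv 3 (fun s ↦ (((Λ i s : lorentzGroup) : E4 ≃L[ℝ] E4) (E4.basisVector 0))) t) atTop (𝓝 0)) ∧ (Tendsto (fun t ↦ iteratedDeriv 1 (fun s ↦ deriv (ξ i) s - (((((Λ i s : lorentzGroup) : E4 ≃L[ℝ] E4) (E4.basisVector 0)) 0)⁻¹ • E4.spatial (((Λ i s : lorentzGroup) : E4 ≃L[ℝ] E4) (E4.basisVector 0)))) t) atTop (𝓝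 0) ∧ Tendsto (fun t ↦ iteratedDeriv 2 (fun s ↦ deriv (ξ i) s - (((((Λ i s : lorentzGroup) : E4 ≃L[ℝ] E4) (E4.basisVector 0)) 0)⁻¹ • E4.spatial (((Λ i s : lorentzGroup) : E4 ≃L[ℝ] E4) (E4.basisVector 0)))) t) atTop (𝓝 0)) ∧ (a i ≠ 0 → Tendsto (fun t ↦ iteratedDeriv 2 (fun s ↦ (((Λ i s : lorentzGroup) : E4 ≃L[ℝ] E4) (E4.basisVector 3))) t) atTop (𝓝 0) ∧ Tendsto (fun t ↦ iteratedDeriv 3 (fun s ↦ (((Λ i s : lorentzGroup) : E4 ≃L[ℝ] E4) (E4.basisVector 3))) t) atTop (𝓝 0))) := by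
  intro N M a rin Λ ξ γ H1 Hγ Hsm Hsep CB RR FIRST
  have hfirst : ∀ j, Tendsto ((fun (j : Fin N) (t : ℝ) ↦ ‖deriv (fun s ↦ (Λ j s : E4 ≃L[ℝ] E4) (E4.basisVector 0)) t‖ +
      ‖deriv (ξ j) t - (((Λ j t : E4 ≃L[ℝ] E4) (E4.basisVector 0)) 0)⁻¹ • E4.spatial ((Λ j t : E4 ≃L[ℝ] E4) (E4.basisVector 0))‖ +
      (if a j = 0 then 0 else ‖deriv (fun s ↦ (Λ j s : E4 ≃L[ℝ] E4) (E4.basisVector 3)) t‖)) j) atTop (𝓝 0) :=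
    fun j ↦ higherOrder_tendsto_firstSize (Λ := Λ j) (ξ := ξ j) (a := a j) (fun _ ↦ rfl)
      (FIRST j).1 (FIRST j).2.1 (FIRST j).2.2
  have hsecond := higherOrder_second_decay H1 Hγ Hsm Hsep CB RR
    (E₂ := fun (j : Fin N) (t : ℝ) ↦ ‖iteratedDeriv 2 (fun s ↦ (Λ j s : E4 ≃L[ℝ] E4) (E4.basisVector 0)) t‖ +
      ‖deriv (fun s ↦ deriv (ξ j) s - (((Λ j s : E4 ≃L[ℝ] E4) (E4.basisVector 0)) 0)⁻¹ •
        E4.spatial ((Λ j s : E4 ≃L[ℝ] E4) (E4.basisVector 0))) t‖ +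
      (if a j = 0 then 0 else ‖iteratedDeriv 2 (fun s ↦ (Λ j s : E4 ≃L[ℝ] E4) (E4.basisVector 3)) t‖))
    (fun _ _ ↦ rfl) (fun _ _ ↦ rfl) hfirst
  have hthird := higherOrder_third_decay H1 Hγ Hsm Hsep CB RR
    (E₂ := fun (j : Fin N) (t : ℝ) ↦ ‖iteratedDeriv 2 (fun s ↦ (Λ j s : E4 ≃L[ℝ] E4) (E4.basisVector 0)) t‖ +
      ‖deriv (fun s ↦ deriv (ξ j) s - (((Λ j s : E4 ≃L[ℝ] E4) (E4.basisVector 0)) 0)⁻¹ •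
        E4.spatial ((Λ j s : E4 ≃L[ℝ] E4) (E4.basisVector 0))) t‖ +
      (if a j = 0 then 0 else ‖iteratedDeriv 2 (fun s ↦ (Λ j s : E4 ≃L[ℝ] E4) (E4.basisVector 3)) t‖))
    (E₃ := fun (j : Fin N) (t : ℝ) ↦ ‖iteratedDeriv 3 (fun s ↦ (Λ j s : E4 ≃L[ℝ] E4) (E4.basisVector 0)) t‖ +
      ‖iteratedDeriv 2 (fun s ↦ deriv (ξ j) s - (((Λ j s : E4 ≃L[ℝ] E4) (E4.basisVector 0)) 0)⁻¹ •
        E4.spatial ((Λ j s : E4 ≃L[ℝ] E4) (E4.basisVector 0))) t‖ +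
      (if a j = 0 then 0 else ‖iteratedDeriv 3 (fun s ↦ (Λ j s : E4 ≃L[ℝ] E4) (E4.basisVector 3)) t‖))
    (fun _ _ ↦ rfl) (fun _ _ ↦ rfl) (fun _ _ ↦ rfl) hfirst hsecond
  intro i
  exact higherOrder_higher_of_sizes (Λ := Λ i) (ξ := ξ i) (a := a i) (fun _ ↦ rfl) (fun _ ↦ rfl)
    (hsecond i) (hthird i)

end Summit.FinalStateConjecture.FinalStateConjecture.Theorems.SublinearIsFree.Slaving

end
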